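import Summits.CriticalPhenomena.Ising3DConformalLimit.Theorems.EnergyNotSigmaSquaredRungOneAdjacentMergingDefs
import Literature.Probability.LatticeModels.IntersectionSecondMoment
import Literature.Probability.LatticeModels.ImprovedTreeDiagramBound
import Literature.Probability.LatticeModels.RandomCurrents
import Literature.Probability.LatticeModels.IsingThermodynamics
import Literature.Probability.LatticeModels.WeightedCurrentsIdentities
import Literature.Probability.LatticeModels.WeightedCurrentsDictionary
import Literature.Probability.LatticeModels.RandomCurrentsProofs
import Literature.Probability.LatticeModels.SourcedDoubleCurrentsSwitchingProofs
import HarnessLib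

/-!
# Mean-one Chebyshev for the duplicated two-centre system (stub `stub_chebyshev`)
(line `dominant-shell-concentration` of the crux `RungOneAdjacentMerging`, item
stmt-CriticalPhenomena-11262, route `EnergyNotSigmaSquared`)

Proves `MeanOneChebyshev` of `Theorems/EnergyNotSigmaSquaredRungOneAdjacentMergingDefs.lean`: the
second-moment (Chebyshev) step of Aizenman–Duminil-Copin 2021 (arXiv:1912.07973) §4.2, proof of
Lemma 4.4, for two independent sourced double currents `p ~ P^{{o}∆{y},∅}`, `q ~ P^{{a}∆{y'},∅}` with two
DIFFERENT centres `o`, `a` on any finite graph with uniform coupling `β ≥ 0`.  With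
`W(p,q) = epairWeight K ({o}∆{y}) ∅ p · epairWeight K ({a}∆{y'}) ∅ q` (`K ≡ β`) and
`N(p,q) = Σ_u c(u) 𝟙[u ∈ C_p(o)] 𝟙[u ∈ C_q(a)]`: the disjointness event lies in `{N = 0}`
(`Chebyshev.count_eq_zero_of_disjoint`); `Σ W N = fvMean` exactly (one-point identity once per system,
`Chebyshev.tsum_pairProd_mul_count`); `Z[∅]² Σ W N² ≤ fvSecond` (Prop. A.3 once per system,
`Chebyshev.sq_mul_tsum_pairProd_mul_count_sq_le`); Cauchy–Schwarz and the cross-multiplied `ℝ≥0∞`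
algebra give `Σ W 𝟙[N = 0] ≤ θ Σ W` (`Chebyshev.tsum_pairProd_mul_indicator_le`); finally the product
`doubleCurrentMeasure` is the normalised series of `W` on the countable configuration space
(dictionary lemmas adapted from the sibling line
`Cruxes/RungOneAdjacentMerging/Lines/marginal-branch-power-law-machine.lean` §3); degenerate
normalisers give the junk measure `0` (tree `doubleCurrentMeasure_eq_zero_of_currentSum`).  No
subtraction in `ℝ≥0∞` is used.

References: M. Aizenman, H. Duminil-Copin, Ann. of Math. 194 (2021), arXiv:1912.07973, §4.2 proof of
Lemma 4.4 and Appendix A Prop. A.3.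
-/


noncomputable section

open MeasureTheory Filter Finset
open scoped BigOperators ENNReal symmDiff
open Literature.Probability.LatticeModels

namespace Summit.CriticalPhenomena.Ising3DConformalLimit.RungOneAdjacentMergingDominantShell

namespace Chebyshev

variable {V : Type} [Fintype V] [DecidableEq V] {G : SimpleGraph V} [DecidableRel G.Adj]

/-! ### Two-centre product weights: Fubini, total mass, first and second moment -/

section TwoCentre

variable {K : G.edgeFinset → ℝ}

/-- Fubini for the two-centre product weight `W(p,q) = w_{A₁,∅}(p) · w_{A₂,∅}(q)` against a product
function: `Σ_{(p,q)} W(p,q) f(p) g(q) = (Σ_p w₁ f) (Σ_q w₂ g)` in `ℝ≥0∞`. [folklore] -/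
theorem tsum_pairProd_mul_mul (K : G.edgeFinset → ℝ) (A₁ A₂ : Finset V)
    (f g : Current G × Current G → ℝ≥0∞) :
    ∑' pq : (Current G × Current G) × (Current G × Current G),
        epairWeight K A₁ ∅ pq.1 * epairWeight K A₂ ∅ pq.2 * (f pq.1 * g pq.2) =
      (∑' p, epairWeight K A₁ ∅ p * f p) * ∑' q, epairWeight K A₂ ∅ q * g q := by
  rw [tsum_mul_tsum_eq_tsum_prod]
  exact tsum_congr fun pq => by ring

/-- Total mass of the two-centre product weight: `Σ W = (Z[A₁] Z[∅]) · (Z[A₂] Z[∅])`. [folklore] -/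
theorem tsum_pairProd (K : G.edgeFinset → ℝ) (A₁ A₂ : Finset V) :
    ∑' pq : (Current G × Current G) × (Current G × Current G),
        epairWeight K A₁ ∅ pq.1 * epairWeight K A₂ ∅ pq.2 =
      (ecurrentSum K A₁ * ecurrentSum K ∅) * (ecurrentSum K A₂ * ecurrentSum K ∅) := by
  rw [← tsum_epairWeight K A₁ ∅, ← tsum_epairWeight K A₂ ∅, tsum_mul_tsum_eq_tsum_prod]

/-- **First moment of the weighted coincidence count, two centres** (Aizenman–Duminil-Copin 2021,
proof of Lemma 4.4, first display, with the centre of the second system moved from `o` to `a`),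
un-normalised and exact: `Σ_{(p,q)} W(p,q) Σ_u c(u) 𝟙[u ∈ C_p(o)] 𝟙[u ∈ C_q(a)]
  = Σ_u c(u) · (Z[ou] Z[uy]) · (Z[au] Z[uy'])` (the one-point switching identity once per system).
[cite: AizenmanDuminilCopinAnnals2021, arXiv:1912.07973 §4.2, proof of Lemma 4.4 (first moment of |𝓜|)] -/
theorem tsum_pairProd_mul_count (hK : ∀ e, 0 ≤ K e) (c : V → ℝ≥0∞) (o a y y' : V) :
    ∑' pq : (Current G × Current G) × (Current G × Current G),
        epairWeight K ({o} ∆ {y}) ∅ pq.1 * epairWeight K ({a} ∆ {y'}) ∅ pq.2 *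
          ∑ u, c u * (Current.connInd u o pq.1 * Current.connInd u a pq.2) =
      ∑ u, c u * ((ecurrentSum K ({o} ∆ {u}) * ecurrentSum K ({u} ∆ {y})) *
        (ecurrentSum K ({a} ∆ {u}) * ecurrentSum K ({u} ∆ {y'}))) := by
  simp_rw [Finset.mul_sum]
  rw [Summable.tsum_finsetSum (fun _ _ => ENNReal.summable)]
  refine Finset.sum_congr rfl fun u _ => ?_
  have h : ∀ pq : (Current G × Current G) × (Current G × Current G),
      epairWeight K ({o} ∆ {y}) ∅ pq.1 * epairWeight K ({a} ∆ {y'}) ∅ pq.2 *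
          (c u * (Current.connInd u o pq.1 * Current.connInd u a pq.2)) =
        c u * (epairWeight K ({o} ∆ {y}) ∅ pq.1 * epairWeight K ({a} ∆ {y'}) ∅ pq.2 *
          (Current.connInd u o pq.1 * Current.connInd u a pq.2)) := fun pq => by ring
  rw [tsum_congr h, ENNReal.tsum_mul_left,
    tsum_pairProd_mul_mul K _ _ (Current.connInd u o) (Current.connInd u a)]
  unfold Current.connInd
  rw [Current.tsum_epairWeight_mul_indicator_mem_cluster hK o y u,
    Current.tsum_epairWeight_mul_indicator_mem_cluster hK a y' u,
    symmDiff_comm ({y} : Finset V) {u}, symmDiff_comm ({y'} : Finset V) {u}]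
  ring

/-- **Second moment of the weighted coincidence count, two centres** (Aizenman–Duminil-Copin 2021,
proof of Lemma 4.4, second and third displays, Proposition A.3 inserted once per system), un-normalised:
`Z[∅]² Σ_{(p,q)} W(p,q) N(p,q)² ≤ Σ_{u,v} c(u)c(v) B_{oy}(u,v) B_{ay'}(u,v)` with the two-step bounds
`B_{oy}(u,v) = Z[ou]Z[uv]Z[vy] + Z[ov]Z[vu]Z[uy]` (`Current.twoStepBound`).
[cite: AizenmanDuminilCopinAnnals2021, arXiv:1912.07973 §4.2, proof of Lemma 4.4 (second moment of |𝓜|)] -/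
theorem sq_mul_tsum_pairProd_mul_count_sq_le (hK : ∀ e, 0 ≤ K e) (c : V → ℝ≥0∞) (o a y y' : V) :
    ecurrentSum K ∅ ^ 2 *
        ∑' pq : (Current G × Current G) × (Current G × Current G),
          epairWeight K ({o} ∆ {y}) ∅ pq.1 * epairWeight K ({a} ∆ {y'}) ∅ pq.2 *
            (∑ u, c u * (Current.connInd u o pq.1 * Current.connInd u a pq.2)) ^ 2 ≤
      ∑ u, ∑ v, c u * c v *
        (Current.twoStepBound K o y u v * Current.twoStepBound K a y' u v) := by
  -- expand the square and exchange sums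
  have hexp : ∀ pq : (Current G × Current G) × (Current G × Current G),
      epairWeight K ({o} ∆ {y}) ∅ pq.1 * epairWeight K ({a} ∆ {y'}) ∅ pq.2 *
          (∑ u, c u * (Current.connInd u o pq.1 * Current.connInd u a pq.2)) ^ 2 =
        ∑ u, ∑ v, c u * c v *
          (epairWeight K ({o} ∆ {y}) ∅ pq.1 * epairWeight K ({a} ∆ {y'}) ∅ pq.2 *
            ((Current.connInd u o pq.1 * Current.connInd v o pq.1) *
              (Current.connInd u a pq.2 * Current.connInd v a pq.2))) := by
    intro pq
    rw [sq, Finset.sum_mul_sum, Finset.mul_sum]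
    refine Finset.sum_congr rfl fun u _ => ?_
    rw [Finset.mul_sum]
    exact Finset.sum_congr rfl fun v _ => by ring
  rw [tsum_congr hexp, Summable.tsum_finsetSum (fun _ _ => ENNReal.summable), Finset.mul_sum]
  refine Finset.sum_le_sum fun u _ => ?_
  rw [Summable.tsum_finsetSum (fun _ _ => ENNReal.summable), Finset.mul_sum]
  refine Finset.sum_le_sum fun v _ => ?_
  rw [ENNReal.tsum_mul_left,
    tsum_pairProd_mul_mul K _ _ (fun p => Current.connInd u o p * Current.connInd v o p)
      (fun q => Current.connInd u a q * Current.connInd v a q)]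
  calc ecurrentSum K ∅ ^ 2 * (c u * c v *
        ((∑' p, epairWeight K ({o} ∆ {y}) ∅ p * (Current.connInd u o p * Current.connInd v o p)) *
          ∑' q, epairWeight K ({a} ∆ {y'}) ∅ q * (Current.connInd u a q * Current.connInd v a q)))
      = c u * c v *
        ((ecurrentSum K ∅ *
            ∑' p, epairWeight K ({o} ∆ {y}) ∅ p * (Current.connInd u o p * Current.connInd v o p)) *
          (ecurrentSum K ∅ *
            ∑' q, epairWeight K ({a} ∆ {y'}) ∅ q * (Current.connInd u a q * Current.connInd v a q))) := by
        ring
    _ ≤ c u * c v * (Current.twoStepBound K o y u v * Current.twoStepBound K a y' u v) :=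
        mul_le_mul' le_rfl
          (mul_le_mul' (Current.ecurrentSum_empty_mul_tsum_connInd_mul_connInd_le hK o y u v)
            (Current.ecurrentSum_empty_mul_tsum_connInd_mul_connInd_le hK a y' u v))

end TwoCentre

/-! ### The disjointness event and the coincidence count -/

/-- On the disjointness event `{no u with o ↔ u in p₁+p₂ and a ↔ u in q₁+q₂}` the weighted
coincidence count `Σ_u c(u) 𝟙[u ∈ C_p(o)] 𝟙[u ∈ C_q(a)]` vanishes. [folklore] -/
theorem count_eq_zero_of_disjoint (c : V → ℝ≥0∞) (o a : V)
    {pq : (Current G × Current G) × (Current G × Current G)}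
    (h : ∀ u : V, ¬ (pq.1 ∈ tracedConn G o u ∧ pq.2 ∈ tracedConn G a u)) :
    ∑ u, c u * (Current.connInd u o pq.1 * Current.connInd u a pq.2) = 0 := by
  refine Finset.sum_eq_zero fun u _ => ?_
  unfold Current.connInd
  by_cases h1 : u ∈ (pq.1.1 + pq.1.2).cluster o
  · have h2 : u ∉ (pq.2.1 + pq.2.2).cluster a := fun h2 =>
      h u ⟨(mem_tracedConn_iff G o u pq.1).2 (Current.mem_cluster_iff.1 h1),
        (mem_tracedConn_iff G a u pq.2).2 (Current.mem_cluster_iff.1 h2)⟩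
    rw [if_neg h2, mul_zero, mul_zero]
  · rw [if_neg h1, zero_mul, mul_zero]

/-- `Σ w = Σ w 𝟙[n ≠ 0] + Σ w 𝟙[n = 0]` for `ℝ≥0∞`-valued families. [folklore] -/
theorem tsum_eq_tsum_indicator_add {ι : Type*} (w n : ι → ℝ≥0∞) :
    ∑' i, w i = (∑' i, w i * (if n i = 0 then 0 else 1)) + ∑' i, w i * (if n i = 0 then 1 else 0) := by
  rw [← ENNReal.tsum_add]
  refine tsum_congr fun i => ?_
  by_cases h : n i = 0
  · simp [h]
  · simp [h]

/-! ### The `ℝ≥0∞` algebra of the second-moment method -/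

/-- **The second-moment method, cross-multiplied in `ℝ≥0∞`**: from the total mass
`R₁Z₀ · R₂Z₀ = P + Q`, Cauchy–Schwarz `M² ≤ P S₂`, the bound `Z₀² S₂ ≤ S` and `R₁R₂ S ≤ (1+θ) M²` with
`0 < M < ∞`, conclude `Q ≤ θ · R₁Z₀ R₂Z₀` (i.e. `P[N = 0] ≤ 1 - E[N]²/E[N²] ≤ θ/(1+θ) ≤ θ`).
[cite: AizenmanDuminilCopinAnnals2021, arXiv:1912.07973 §4.2, proof of Lemma 4.4 (second-moment inequality)] -/
theorem secondMoment_algebra {M P Q S₂ S R₁ R₂ Z₀ : ℝ≥0∞} {θ : ℝ} (hθ : 0 ≤ θ)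
    (hM0 : M ≠ 0) (hMt : M ≠ ∞) (hT : R₁ * Z₀ * (R₂ * Z₀) ≠ ∞)
    (hPQ : R₁ * Z₀ * (R₂ * Z₀) = P + Q) (hCS : M ^ 2 ≤ P * S₂) (hS : Z₀ ^ 2 * S₂ ≤ S)
    (hSM : R₁ * R₂ * S ≤ ENNReal.ofReal (1 + θ) * M ^ 2) :
    Q ≤ ENNReal.ofReal θ * (R₁ * Z₀ * (R₂ * Z₀)) := by
  have h1 : M ^ 2 * (R₁ * Z₀ * (R₂ * Z₀)) ≤ M ^ 2 * (ENNReal.ofReal (1 + θ) * P) :=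
    calc M ^ 2 * (R₁ * Z₀ * (R₂ * Z₀)) ≤ P * S₂ * (R₁ * Z₀ * (R₂ * Z₀)) := mul_le_mul' hCS le_rfl
      _ = P * (R₁ * R₂ * (Z₀ ^ 2 * S₂)) := by ring
      _ ≤ P * (R₁ * R₂ * S) := mul_le_mul' le_rfl (mul_le_mul' le_rfl hS)
      _ ≤ P * (ENNReal.ofReal (1 + θ) * M ^ 2) := mul_le_mul' le_rfl hSM
      _ = M ^ 2 * (ENNReal.ofReal (1 + θ) * P) := by ring
  have h2 : R₁ * Z₀ * (R₂ * Z₀) ≤ ENNReal.ofReal (1 + θ) * P :=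
    (ENNReal.mul_le_mul_iff_right (pow_ne_zero 2 hM0) (ENNReal.pow_ne_top hMt)).1 h1
  have hPle : P ≤ R₁ * Z₀ * (R₂ * Z₀) := le_self_add.trans hPQ.ge
  have hPt : P ≠ ∞ := ne_top_of_le_ne_top hT hPle
  have h3 : P + Q ≤ P + ENNReal.ofReal θ * P := by
    rw [← hPQ]
    calc R₁ * Z₀ * (R₂ * Z₀) ≤ ENNReal.ofReal (1 + θ) * P := h2
      _ = P + ENNReal.ofReal θ * P := by
        rw [ENNReal.ofReal_add zero_le_one hθ, ENNReal.ofReal_one, add_mul, one_mul]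
  calc Q ≤ ENNReal.ofReal θ * P := (ENNReal.add_le_add_iff_left hPt).1 h3
    _ ≤ ENNReal.ofReal θ * (R₁ * Z₀ * (R₂ * Z₀)) := mul_le_mul' le_rfl hPle

/-- **The un-normalised Chebyshev bound for the duplicated two-centre system** (uniform coupling
`β ≥ 0`): under `SecondMomentData`'s inequality for the weights `c`,
`Σ_{(p,q)} W(p,q) 𝟙[N(p,q) = 0] ≤ θ · (Z[oy]Z[∅]) (Z[ay']Z[∅])`.
[cite: AizenmanDuminilCopinAnnals2021, arXiv:1912.07973 §4.2, proof of Lemma 4.4 (second-moment method)] -/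
theorem tsum_pairProd_mul_indicator_le {β : ℝ} (hβ : 0 ≤ β) {θ : ℝ} (hθ : 0 ≤ θ) (c : V → ℝ≥0∞)
    (o a y y' : V) (hM0 : fvMean G β o a y y' c ≠ 0) (hMt : fvMean G β o a y y' c ≠ ∞)
    (hSM : ecurrentSum (fun _ : ↥G.edgeFinset => β) ({o} ∆ {y}) *
        ecurrentSum (fun _ : ↥G.edgeFinset => β) ({a} ∆ {y'}) * fvSecond G β o a y y' c ≤
      ENNReal.ofReal (1 + θ) * fvMean G β o a y y' c ^ 2) :
    ∑' pq : (Current G × Current G) × (Current G × Current G),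
        epairWeight (fun _ : ↥G.edgeFinset => β) ({o} ∆ {y}) ∅ pq.1 *
            epairWeight (fun _ : ↥G.edgeFinset => β) ({a} ∆ {y'}) ∅ pq.2 *
          (if ∑ u, c u * (Current.connInd u o pq.1 * Current.connInd u a pq.2) = 0 then 1 else 0) ≤
      ENNReal.ofReal θ *
        ((ecurrentSum (fun _ : ↥G.edgeFinset => β) ({o} ∆ {y}) *
            ecurrentSum (fun _ : ↥G.edgeFinset => β) ∅) *
          (ecurrentSum (fun _ : ↥G.edgeFinset => β) ({a} ∆ {y'}) *
            ecurrentSum (fun _ : ↥G.edgeFinset => β) ∅)) := by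
  have hK : ∀ _e : ↥G.edgeFinset, 0 ≤ β := fun _ => hβ
  -- total mass, split along `𝟙[N ≠ 0] + 𝟙[N = 0]`
  have hPQ := tsum_eq_tsum_indicator_add
    (fun pq : (Current G × Current G) × (Current G × Current G) =>
      epairWeight (fun _ : ↥G.edgeFinset => β) ({o} ∆ {y}) ∅ pq.1 *
        epairWeight (fun _ : ↥G.edgeFinset => β) ({a} ∆ {y'}) ∅ pq.2)
    (fun pq => ∑ u, c u * (Current.connInd u o pq.1 * Current.connInd u a pq.2))
  rw [tsum_pairProd (fun _ : ↥G.edgeFinset => β) ({o} ∆ {y}) ({a} ∆ {y'})] at hPQ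
  -- Cauchy–Schwarz
  have hCS := Current.tsum_mul_sq_le_tsum_indicator_mul_tsum_sq
    (fun pq : (Current G × Current G) × (Current G × Current G) =>
      epairWeight (fun _ : ↥G.edgeFinset => β) ({o} ∆ {y}) ∅ pq.1 *
        epairWeight (fun _ : ↥G.edgeFinset => β) ({a} ∆ {y'}) ∅ pq.2)
    (fun pq => ∑ u, c u * (Current.connInd u o pq.1 * Current.connInd u a pq.2))
  rw [tsum_pairProd_mul_count hK c o a y y'] at hCS
  -- second moment
  have hS := sq_mul_tsum_pairProd_mul_count_sq_le hK c o a y y'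
  -- algebra
  have hT : ecurrentSum (fun _ : ↥G.edgeFinset => β) ({o} ∆ {y}) *
        ecurrentSum (fun _ : ↥G.edgeFinset => β) ∅ *
      (ecurrentSum (fun _ : ↥G.edgeFinset => β) ({a} ∆ {y'}) *
        ecurrentSum (fun _ : ↥G.edgeFinset => β) ∅) ≠ ∞ :=
    ENNReal.mul_ne_top (ENNReal.mul_ne_top (ecurrentSum_ne_top hK _) (ecurrentSum_ne_top hK _))
      (ENNReal.mul_ne_top (ecurrentSum_ne_top hK _) (ecurrentSum_ne_top hK _))
  exact secondMoment_algebra hθ hM0 hMt hT hPQ hCS hS hSM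

/-! ### Dictionary: the product double-current measure as a series of `ℝ≥0∞` pair weights
(adapted from `Cruxes/RungOneAdjacentMerging/Lines/marginal-branch-power-law-machine.lean` §3) -/

-- adapted from Cruxes/RungOneAdjacentMerging/Lines/marginal-branch-power-law-machine.lean §3
/-- The double-current measure of a singleton is its normalised pair weight. [folklore] -/
theorem doubleCurrentMeasure_apply_singleton (β : ℝ) (A B : Finset V) (p : Current G × Current G) :
    doubleCurrentMeasure G β A B {p} =
      ENNReal.ofReal (pairWeight G β A B p / (currentSum G β A * currentSum G β B)) := by
  classical
  rw [doubleCurrentMeasure, Measure.sum_apply _ (measurableSet_singleton p)]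
  simp only [Measure.smul_apply, smul_eq_mul, Measure.dirac_apply' _ (measurableSet_singleton p)]
  rw [tsum_eq_single p]
  · simp
  · intro q hq
    simp [hq]

-- adapted from Cruxes/RungOneAdjacentMerging/Lines/marginal-branch-power-law-machine.lean §3
/-- The product of two double-current measures on a singleton. [folklore] -/
theorem prod_doubleCurrentMeasure_apply_singleton (β : ℝ) (A₁ B₁ A₂ B₂ : Finset V)
    (pq : (Current G × Current G) × (Current G × Current G)) :
    ((doubleCurrentMeasure G β A₁ B₁).prod (doubleCurrentMeasure G β A₂ B₂)) {pq} =
      ENNReal.ofReal (pairWeight G β A₁ B₁ pq.1 / (currentSum G β A₁ * currentSum G β B₁)) *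
        ENNReal.ofReal (pairWeight G β A₂ B₂ pq.2 / (currentSum G β A₂ * currentSum G β B₂)) := by
  haveI : SFinite (doubleCurrentMeasure G β A₂ B₂) := by
    unfold doubleCurrentMeasure; infer_instance
  obtain ⟨p, q⟩ := pq
  rw [← Set.singleton_prod_singleton, Measure.prod_prod, doubleCurrentMeasure_apply_singleton,
    doubleCurrentMeasure_apply_singleton]

-- adapted from Cruxes/RungOneAdjacentMerging/Lines/marginal-branch-power-law-machine.lean §3
/-- **The product of two double-current measures of an event, as a series** over the countable
configuration space of the four currents. [folklore] -/
theorem prod_doubleCurrentMeasure_apply (β : ℝ) (A₁ B₁ A₂ B₂ : Finset V)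
    (E : Set ((Current G × Current G) × (Current G × Current G))) :
    ((doubleCurrentMeasure G β A₁ B₁).prod (doubleCurrentMeasure G β A₂ B₂)) E =
      ∑' pq, E.indicator (fun pq =>
        ENNReal.ofReal (pairWeight G β A₁ B₁ pq.1 / (currentSum G β A₁ * currentSum G β B₁)) *
          ENNReal.ofReal (pairWeight G β A₂ B₂ pq.2 / (currentSum G β A₂ * currentSum G β B₂))) pq := by
  rw [← Measure.tsum_indicator_apply_singleton _ E (Set.to_countable E).measurableSet]
  refine tsum_congr fun pq => ?_
  by_cases hpq : pq ∈ E
  · rw [Set.indicator_of_mem hpq, Set.indicator_of_mem hpq]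
    exact prod_doubleCurrentMeasure_apply_singleton β A₁ B₁ A₂ B₂ pq
  · rw [Set.indicator_of_notMem hpq, Set.indicator_of_notMem hpq]

/-- The real pair weight cast to `ℝ≥0∞` is the tree's `ℝ≥0∞` pair weight of the constant coupling
`K ≡ β ≥ 0` (same order of the two currents). [folklore] -/
theorem ofReal_pairWeight_eq_epairWeight {β : ℝ} (hβ : 0 ≤ β) (A B : Finset V)
    (p : Current G × Current G) :
    ENNReal.ofReal (pairWeight G β A B p) = epairWeight (fun _ : ↥G.edgeFinset => β) A B p := by
  unfold pairWeight epairWeight Current.eweight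
  split_ifs with h
  · rw [ENNReal.ofReal_mul (Current.weight_nonneg hβ _)]
    rfl
  · exact ENNReal.ofReal_zero

-- adapted from Cruxes/RungOneAdjacentMerging/Lines/marginal-branch-power-law-machine.lean §3
/-- The real current sum cast to `ℝ≥0∞` is the tree's `ℝ≥0∞` current sum (`K ≡ β ≥ 0`). [folklore] -/
theorem ofReal_currentSum_eq_ecurrentSum {β : ℝ} (hβ : 0 ≤ β) (A : Finset V) :
    ENNReal.ofReal (currentSum G β A) = ecurrentSum (fun _ : ↥G.edgeFinset => β) A := by
  rw [currentSum_eq_wcurrentSum, ecurrentSum_eq_ofReal (fun _ => hβ)]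

end Chebyshev

/-- STUB 1 (M) — **MEAN-ONE CHEBYSHEV** for the duplicated two-centre system on ANY finite graph with
uniform coupling `β ≥ 0`: if weights `c ≥ 0` satisfy `Z[oy]Z[ay']·fvSecond ≤ (1+θ)·fvMean²`
(`0 < fvMean < ∞`), then `P^{oy,∅} ⊗ P^{ay',∅}[no u with o ↔ u in n₁+n₃ and a ↔ u in n₂+n₄] ≤ θ`
(the event is in `{N = 0}`, `E N` exact, `E N²` by Prop. A.3 once per system,
`P[N = 0] ≤ 1 - E[N]²/E[N²] ≤ θ`; degenerate normalisers give the junk measure `0`).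
[cite: AizenmanDuminilCopinAnnals2021, arXiv:1912.07973 §4.2, proof of Lemma 4.4 (second-moment method) and Appendix A Prop. A.3] -/
theorem stub_chebyshev :
    ∀ (V : Type) [Fintype V] [DecidableEq V] (G : SimpleGraph V) [DecidableRel G.Adj] (β : ℝ), 0 ≤ β →
      ∀ θ : ℝ, 0 ≤ θ → ∀ o a y y' : V, SecondMomentData G β θ o a y y' →
        ((doubleCurrentMeasure G β ({o} ∆ {y}) ∅).prod (doubleCurrentMeasure G β ({a} ∆ {y'}) ∅)).real
            {pq | ∀ u : V, ¬ (pq.1 ∈ tracedConn G o u ∧ pq.2 ∈ tracedConn G a u)} ≤ θ := by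
  intro V _ _ G _ β hβ θ hθ o a y y' hData
  obtain ⟨c, hM0, hMt, hSM⟩ := hData
  have hK : ∀ _e : ↥G.edgeFinset, 0 ≤ β := fun _ => hβ
  set E : Set ((Current G × Current G) × (Current G × Current G)) :=
    {pq | ∀ u : V, ¬ (pq.1 ∈ tracedConn G o u ∧ pq.2 ∈ tracedConn G a u)} with hE
  -- degenerate normalisers: the junk measure `0`
  by_cases hZ₁ : currentSum G β ({o} ∆ {y}) * currentSum G β ∅ = 0
  · rw [measureReal_def, doubleCurrentMeasure_eq_zero_of_currentSum G hZ₁,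
      Measure.zero_prod, Measure.coe_zero, Pi.zero_apply, ENNReal.toReal_zero]
    exact hθ
  by_cases hZ₂ : currentSum G β ({a} ∆ {y'}) * currentSum G β ∅ = 0
  · rw [measureReal_def, doubleCurrentMeasure_eq_zero_of_currentSum G hZ₂,
      Measure.prod_zero, Measure.coe_zero, Pi.zero_apply, ENNReal.toReal_zero]
    exact hθ
  have hZ₁pos : 0 < currentSum G β ({o} ∆ {y}) * currentSum G β ∅ :=
    lt_of_le_of_ne (mul_nonneg (currentSum_nonneg G hβ _) (currentSum_nonneg G hβ _)) (Ne.symm hZ₁)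
  have hZ₂pos : 0 < currentSum G β ({a} ∆ {y'}) * currentSum G β ∅ :=
    lt_of_le_of_ne (mul_nonneg (currentSum_nonneg G hβ _) (currentSum_nonneg G hβ _)) (Ne.symm hZ₂)
  -- the normaliser in `ℝ≥0∞`
  have hN : ENNReal.ofReal (currentSum G β ({o} ∆ {y}) * currentSum G β ∅) *
      ENNReal.ofReal (currentSum G β ({a} ∆ {y'}) * currentSum G β ∅) =
      ecurrentSum (fun _ : ↥G.edgeFinset => β) ({o} ∆ {y}) *
          ecurrentSum (fun _ : ↥G.edgeFinset => β) ∅ *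
        (ecurrentSum (fun _ : ↥G.edgeFinset => β) ({a} ∆ {y'}) *
          ecurrentSum (fun _ : ↥G.edgeFinset => β) ∅) := by
    rw [ENNReal.ofReal_mul (currentSum_nonneg G hβ _), ENNReal.ofReal_mul (currentSum_nonneg G hβ _)]
    simp only [Chebyshev.ofReal_currentSum_eq_ecurrentSum hβ]
  have hT0 := mul_ne_zero (ENNReal.ofReal_pos.2 hZ₁pos).ne' (ENNReal.ofReal_pos.2 hZ₂pos).ne'
  have hTt := ENNReal.mul_ne_top
    (@ENNReal.ofReal_ne_top (currentSum G β ({o} ∆ {y}) * currentSum G β ∅))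
    (@ENNReal.ofReal_ne_top (currentSum G β ({a} ∆ {y'}) * currentSum G β ∅))
  -- pointwise: (normalised product weight on `E`) · normaliser = `W · 𝟙_E ≤ W · 𝟙[N = 0]`
  have hpt : ∀ pq : (Current G × Current G) × (Current G × Current G),
      E.indicator (fun pq =>
          ENNReal.ofReal (pairWeight G β ({o} ∆ {y}) ∅ pq.1 /
              (currentSum G β ({o} ∆ {y}) * currentSum G β ∅)) *
            ENNReal.ofReal (pairWeight G β ({a} ∆ {y'}) ∅ pq.2 /
              (currentSum G β ({a} ∆ {y'}) * currentSum G β ∅))) pq *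
          (ENNReal.ofReal (currentSum G β ({o} ∆ {y}) * currentSum G β ∅) *
            ENNReal.ofReal (currentSum G β ({a} ∆ {y'}) * currentSum G β ∅)) ≤
        epairWeight (fun _ : ↥G.edgeFinset => β) ({o} ∆ {y}) ∅ pq.1 *
            epairWeight (fun _ : ↥G.edgeFinset => β) ({a} ∆ {y'}) ∅ pq.2 *
          (if ∑ u, c u * (Current.connInd u o pq.1 * Current.connInd u a pq.2) = 0 then 1 else 0) := by
    intro pq
    by_cases hmem : pq ∈ E
    · rw [Set.indicator_of_mem hmem,
        if_pos (Chebyshev.count_eq_zero_of_disjoint c o a (by rw [hE] at hmem; exact hmem)),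
        mul_one, mul_mul_mul_comm,
        ← ENNReal.ofReal_mul (div_nonneg (pairWeight_nonneg G hβ _ _ _) hZ₁pos.le),
        ← ENNReal.ofReal_mul (div_nonneg (pairWeight_nonneg G hβ _ _ _) hZ₂pos.le),
        div_mul_cancel₀ _ hZ₁, div_mul_cancel₀ _ hZ₂,
        Chebyshev.ofReal_pairWeight_eq_epairWeight hβ, Chebyshev.ofReal_pairWeight_eq_epairWeight hβ]
    · rw [Set.indicator_of_notMem hmem, zero_mul]
      exact bot_le
  have hle : ((doubleCurrentMeasure G β ({o} ∆ {y}) ∅).prod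
      (doubleCurrentMeasure G β ({a} ∆ {y'}) ∅)) E ≤ ENNReal.ofReal θ := by
    rw [← ENNReal.mul_le_mul_iff_left hT0 hTt, Chebyshev.prod_doubleCurrentMeasure_apply,
      ← ENNReal.tsum_mul_right]
    refine (ENNReal.tsum_le_tsum hpt).trans ?_
    rw [hN]
    exact Chebyshev.tsum_pairProd_mul_indicator_le hβ hθ c o a y y' hM0 hMt hSM
  rw [measureReal_def]
  exact ENNReal.toReal_le_of_le_ofReal hθ hle

end Summit.CriticalPhenomena.Ising3DConformalLimit.RungOneAdjacentMergingDominantShell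

end
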